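import Summits.ResolutionOfSingularities.ResolutionOfSingularities.Theorems.WeightedInvariantHypersurfaceLocalGameEFT4SDimLETwoIota
import Summits.ResolutionOfSingularities.ResolutionOfSingularities.Theorems.WeightedInvariantContactCentreFiltrationBasic
import Summits.ResolutionOfSingularities.ResolutionOfSingularities.Theorems.WeightedInvariantContactCentreFiltrationEssSmooth
import Summits.ResolutionOfSingularities.ResolutionOfSingularities.Theorems.WeightedInvariantHypersurfaceLocalGameEFT4SDimLETwoGame
import Summits.ResolutionOfSingularities.ResolutionOfSingularities.Theorems.WeightedInvariantHypersurfaceLocalGameEFT4SDimLETwoOpenFinal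
import HarnessLib

/-!
# KEY-RUNG P2 closed by name: `stub_keyRung_dimLETwo : ∀ p, p.Prime → P2Rung p iotaOrd jContact`
# (door `HypersurfaceCentreConstruction`, stmt-ResolutionOfSingularities-19897, skeleton `local-engine` v3.6 PART 4)

[OURS · L1 W4.3 · cell `res-hironaka`, HUMAN RULING D-0089] Helper file `--supports stmt-ResolutionOfSingularities-19897`.
P2 ASSEMBLER res-type-073 (res-L1-w43-plan-1 DEALS gen 9 #19, HOME/STATUS 2026-08-27T09:15:21Z). AI-produced, weaker than
expert review. NOT a statement of the manuscript under review (Hironaka 2017, [claim: Hironaka2017, status: under-review]);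
nothing here is attributed to its author; nothing here is a claim about resolution of singularities. No definitions, no new
mathematics: the registered KEY-RUNG stub of the door skeleton `L/res-L1-w43-plan-1/door_local_engine_v36.lean`
(sha16 `cf8a231841b76189`, PART 4, namespace `…Cruxes.HypersurfaceCentreConstruction.LocalEngine`, text VERBATIM below) is
closed BY NAME from the five `J`-pieces of ORDER (o24) through the combinator `forall_p2Rung_iotaOrd_of_pieces`
(`…EFT4SDimLETwoIota`, p513736; the five ι-only conjuncts of `P2Rung` are the tree theorems `iotaOrd_isoInvariant`,
`iotaOrd_generizationMonotone`, `iotaOrd_upperSemicontinuous`, `iotaOrd_torusFactorMonotone`, `iotaOrd_unitInvariant`,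
p502169 / p502844):

* (o24-D) `jContact_isoInvariant : JIsoInvariant jContact`, `jContact_unitInvariant : JUnitInvariant jContact` — res-type-092,
  `…ContactCentreFiltrationBasic` (p515814; definitions `…ContactCentreFiltration` p514802, regular-ring kit
  `…ContactCentreFiltrationRegular` p516684);
* (o24-C) `EssSmoothCentre.iotaJEssSmoothCompatibleLE2_iotaOrd_jContact : IotaJEssSmoothCompatibleLE2 iotaOrd jContact` —
  res-type-078 (`…ContactCentreFiltrationEssSmooth`, p519849; with `…EssSmoothMonomialTypeDescent` p517017,
  `…ContactFiltrationEssSmoothLevels` p518970, and res-type-070's residue-field package `…FormallySmoothResidueBinomial` p518129);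
* (o24-G) `LocalGameEFTDimTwoGame.canonicalGameClauseLE2_iotaOrd_jContact : ∀ p, CanonicalGameClauseLE2 p iotaOrd jContact` —
  res-type-098 (`…EFT4SDimLETwoGame`, p518250; terminal certificate `…EFT4SDimLETwoGameTerminal` p516687, K7 `…EFTDimTwo`
  p515237, dimension-one adapters of res-type-025 `…EFT4SDimLETwoDimOne` p516578/p517167);
* (o24-O) `GenericEquimultiplicity.jOpenPresentationForallSingLE2_iotaOrd_jContact : ∀ p, JOpenPresentationForallSingLE2 p
  iotaOrd jContact` — res-type-005 (`…EFT4SDimLETwoOpenFinal`, p518517; assembly `…EFT4SDimLETwoOpen` p517736, closed point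
  `…OpenClosedPoint` p516179, `husc`/stratum iff `…IotaOrderHusc` p515109, res-type-025's monomial half
  `…OpenMonomial` p515455).

What the rung says (and does not): for every prime `p`, the ten clauses of the KEY `LocalWeightedDropEFT4S p`
(`…HypersurfaceLocalGameEFT4S`, p504475) hold for the ONE intrinsic pair (`iotaOrd`, `jContact`) when every
regular-local-ring binder of the three position-dependent clauses (c11), (c9′)+(c12b), (open″) is restricted to Krull
dimension ≤ 2 (`P2Rung`, `…EFT4SDimLETwo`, p512950). It is a COUNTED RUNG of the key, not the key: Krull dimension ≥ 3
(regime P3: cylinder rule for `J`, unrestricted (c11), (strat) for `ι`) is NOT claimed, and the kill templates of record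
((o27) p510528 / p511824, specimen `z²+x³y³` p507306) stand against `ι = iotaOrd` for the unrestricted key.
-/

noncomputable section

set_option linter.dupNamespace false -- mandated namespace `Summit.<Summit>.<Problem>` of this single-conjunct summit

open IsLocalRing Literature.AlgebraicGeometry.Resolution
open Summit.ResolutionOfSingularities.ResolutionOfSingularities.Theorems

namespace Summit.ResolutionOfSingularities.ResolutionOfSingularities.Cruxes.HypersurfaceCentreConstruction.LocalEngine

/-- **KEY-RUNG P2 from its three position-dependent pieces** (the two transport pieces (o24-D) `jContact_isoInvariant`,
`jContact_unitInvariant` are supplied from the tree): the seam the registry stub is closed through,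
`forall_p2Rung_iotaOrd_of_pieces jContact jContact_isoInvariant · · · jContact_unitInvariant`. [OURS · L1 W4.3, kernel bookkeeping] -/
theorem keyRung_dimLETwo_of_pieces (hc11 : IotaJEssSmoothCompatibleLE2 iotaOrd jContact)
    (hgame : ∀ p : ℕ, p.Prime → CanonicalGameClauseLE2 p iotaOrd jContact)
    (hopen : ∀ p : ℕ, p.Prime → JOpenPresentationForallSingLE2 p iotaOrd jContact) :
    ∀ p : ℕ, p.Prime → P2Rung p iotaOrd jContact :=
  forall_p2Rung_iotaOrd_of_pieces jContact jContact_isoInvariant hc11 hgame hopen jContact_unitInvariant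

/-- **stub_keyRung_dimLETwo** (registry text VERBATIM — skeleton `local-engine` v3.6 PART 4, ORDER (o24); L).  For every prime
`p`, the ten clauses of the KEY hold for the intrinsic pair (`iotaOrd`, `jContact`) with every regular-local-ring binder of
(c11), (c9′)+(c12b) and (open″) restricted to Krull dimension ≤ 2: the five ι-clauses are tree theorems (p502169, p502844),
the five J-pieces are (o24-D) `jContact_isoInvariant` / `jContact_unitInvariant` (res-type-092), (o24-C)
`EssSmoothCentre.iotaJEssSmoothCompatibleLE2_iotaOrd_jContact` (res-type-078 + res-type-070), (o24-G)
`LocalGameEFTDimTwoGame.canonicalGameClauseLE2_iotaOrd_jContact` (res-type-098 + res-type-025), (o24-O)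
`GenericEquimultiplicity.jOpenPresentationForallSingLE2_iotaOrd_jContact` (res-type-005 + res-type-025); assembly
`forall_p2Rung_iotaOrd_of_pieces` (res-type-073). Krull dimension ≥ 3 (regime P3) is NOT claimed.
[OURS · L1 W4.3 · counted rung of the KEY `LocalWeightedDropEFT4S`, not the KEY] -/
theorem stub_keyRung_dimLETwo : ∀ p : ℕ, p.Prime → P2Rung p iotaOrd jContact :=
  keyRung_dimLETwo_of_pieces EssSmoothCentre.iotaJEssSmoothCompatibleLE2_iotaOrd_jContact
    (fun p _ => LocalGameEFTDimTwoGame.canonicalGameClauseLE2_iotaOrd_jContact p)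
    (fun p _ => GenericEquimultiplicity.jOpenPresentationForallSingLE2_iotaOrd_jContact p)

/-- The rung at `p = 2` (usage witness, as in the skeleton). [OURS · L1 W4.3, kernel bookkeeping] -/
theorem keyRung_dimLETwo_two : P2Rung 2 iotaOrd jContact :=
  stub_keyRung_dimLETwo 2 Nat.prime_two

end Summit.ResolutionOfSingularities.ResolutionOfSingularities.Cruxes.HypersurfaceCentreConstruction.LocalEngine

end
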